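import Summits.Ventures.Crystal3D.Theorems.StickyWulffConstantStackingLiminfLayerMajorant
import Summits.Ventures.Crystal3D.Theorems.StickyWulffConstantStackingLiminfLayerCells
import Summits.Ventures.Crystal3D.Theorems.StickyWulffConstantStackingLiminfMollifierRegularity
import HarnessLib

/-!
# Per-layer quadrature of the mollifier at rate `K⁻²` (step S4(i) of stub (B), line `LayerChain` v4,
# crux `StackingLiminf`, stmt-Ventures-19145): the bumps of one triangular layer sum to
# `(2/√3)·layerProf K ζ ± C·bumpConst/K²`

Route `StickyWulffConstant` of the venture `Summits/Ventures/Crystal3D` (cell `crystal3d-full`).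
For a layer with lateral points `P(i,j) = (i + j/2 + c₁, (√3/2) j + c₂)` seen from a point `y` at height
offset `ζ` (summand `bump K (y₁ − P₁, y₂ − P₂, ζ)`):
* `layerSum_le` — for EVERY finite index set `F`:
  `Σ_{(i,j) ∈ F} φ_K(y − P(i,j), ζ) ≤ (2/√3)·(layerProf K ζ + 12·bumpConst·(2(K+2))²/K⁴)`;
* `layerSum_ge` — if `F` contains every `(i,j)` with lateral distance `< K` from `y`:
  `(2/√3)·(layerProf K ζ − 12·bumpConst·(2K)²/K⁴) ≤ Σ_{(i,j) ∈ F} φ_K(y − P(i,j), ζ)`.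
(`2/√3 = 1/(cell area)`; rectangle cells of `…LayerCells`, lateral majorant/minorant and their Lipschitz
comparisons of `…LayerMajorant`.)  Summed over the `≤ 3K` layers that meet a vertical `K`-window and
combined with the definition of `window σ K`, these give the skew estimate
`|V⁻_full − f̄·v_full| ≤ C·bumpConst/K` of BLUEPRINT-v4B S4(i).
WHAT THIS IS NOT: not stub (B); rung F-C1 not moved.
-/

noncomputable section

namespace Summit.Ventures.Crystal3D.Theorems.PlateauHeight

open MeasureTheory Set Metric
open Summit.Ventures.Crystal3D.Cruxes.StackingLiminf.LayerChainV4 (bump bumpConst layerProf)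
open Summit.Ventures.Crystal3D.LayerChain (dot3)
open Literature.InformationTheory.Coding.Polar (sqrt_sq_add_sq_add_le)

/-! ### Integrability and the integrals of majorant / minorant -/

/-- Volume of a sup-norm ball in `ℝ × ℝ`. -/
theorem volume_closedBall_prod_toReal (y : ℝ × ℝ) {R : ℝ} (hR : 0 ≤ R) :
    (volume (closedBall y R)).toReal = (2 * R) * (2 * R) := by
  rw [← closedBall_prod_same, Measure.volume_eq_prod, Measure.prod_prod, Real.volume_closedBall,
    Real.volume_closedBall, ENNReal.toReal_mul, ENNReal.toReal_ofReal (by linarith)]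

/-- The lateral length of a point of a cell relative to its base point is `≤ 2`. -/
theorem sqrt_le_two_of_cell {q p : ℝ × ℝ}
    (h : 0 ≤ q.1 - p.1 ∧ q.1 - p.1 < 1 ∧ 0 ≤ q.2 - p.2 ∧ q.2 - p.2 < Real.sqrt 3 / 2) :
    Real.sqrt ((q.1 - p.1) ^ 2 + (q.2 - p.2) ^ 2) ≤ 2 := by
  have h3 : Real.sqrt 3 / 2 < 1 := by
    rw [div_lt_one (by norm_num : (0:ℝ) < 2)]
    rw [show (2 : ℝ) = Real.sqrt (2 ^ 2) by rw [Real.sqrt_sq (by norm_num)]]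
    exact Real.sqrt_lt_sqrt (by norm_num) (by norm_num)
  rw [show (2 : ℝ) = Real.sqrt (2 ^ 2) by rw [Real.sqrt_sq (by norm_num)]]
  exact Real.sqrt_le_sqrt (by nlinarith)

/-- The translated bump in the plane integrates to `layerProf K ζ`. -/
theorem integral_bump_sub_eq_layerProf (K ζ : ℝ) (y : ℝ × ℝ) :
    ∫ q : ℝ × ℝ, bump K (![q.1 - y.1, q.2 - y.2, ζ] : Fin 3 → ℝ) = layerProf K ζ := by
  unfold layerProf
  exact integral_sub_right_eq_self (fun z : ℝ × ℝ => bump K (![z.1, z.2, ζ] : Fin 3 → ℝ)) y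

/-- The translated bump in the plane is integrable (`K > 0`). -/
theorem integrable_bump_sub_plane {K : ℝ} (hK : 0 < K) (ζ : ℝ) (y : ℝ × ℝ) :
    Integrable fun q : ℝ × ℝ => bump K (![q.1 - y.1, q.2 - y.2, ζ] : Fin 3 → ℝ) := by
  have hc : Continuous fun q : ℝ × ℝ => bump K (![q.1 - y.1, q.2 - y.2, ζ] : Fin 3 → ℝ) :=
    (continuous_bump K).comp (continuous_pi fun j => by fin_cases j <;> simp <;> fun_prop)
  refine hc.integrable_of_hasCompactSupport (HasCompactSupport.intro (isCompact_closedBall y K) ?_)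
  intro q hq
  rw [mem_closedBall, dist_eq_norm, not_le, Prod.norm_def, lt_max_iff] at hq
  rcases hq with h | h
  · exact bump_eq_zero_of_coord hK 0 (by simpa [Real.norm_eq_abs] using h.le)
  · exact bump_eq_zero_of_coord hK 1 (by simpa [Real.norm_eq_abs] using h.le)

/-- The lateral majorant is continuous. -/
theorem continuous_lateral_majorant (K ζ : ℝ) (y : ℝ × ℝ) :
    Continuous fun q : ℝ × ℝ => bumpConst / K ^ 3 *
      (max 0 (1 - (max 0 (Real.sqrt ((max 0 (Real.sqrt ((q.1 - y.1) ^ 2 + (q.2 - y.2) ^ 2) - 2)) ^ 2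
        + ζ ^ 2) / K)) ^ 2)) ^ 3 := by
  fun_prop

/-- The lateral minorant is continuous. -/
theorem continuous_lateral_minorant (K ζ : ℝ) (y : ℝ × ℝ) :
    Continuous fun q : ℝ × ℝ => bumpConst / K ^ 3 *
      (max 0 (1 - (max 0 (Real.sqrt ((Real.sqrt ((q.1 - y.1) ^ 2 + (q.2 - y.2) ^ 2) + 2) ^ 2
        + ζ ^ 2) / K)) ^ 2)) ^ 3 := by
  fun_prop

/-- **Upper per-layer bound.**  For every finite index set `F`:
`Σ_{(i,j)∈F} φ_K(y − P(i,j), ζ) ≤ (2/√3)·(layerProf K ζ + 12·bumpConst·(2(K+2))²/K⁴)`. -/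
theorem layerSum_le (c₁ c₂ : ℝ) {K : ℝ} (hK : 1 ≤ K) (ζ : ℝ) (y : ℝ × ℝ) (F : Finset (ℤ × ℤ)) :
    ∑ t ∈ F, bump K (![y.1 - ((t.1 : ℝ) + t.2 / 2 + c₁), y.2 - (Real.sqrt 3 / 2 * t.2 + c₂), ζ] :
        Fin 3 → ℝ) ≤
      2 / Real.sqrt 3 * (layerProf K ζ + 12 * bumpConst / K ^ 4 * ((2 * (K + 2)) * (2 * (K + 2)))) := by
  classical
  have hK0 : 0 < K := by linarith
  have h3 : 0 < Real.sqrt 3 := Real.sqrt_pos.2 (by norm_num)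
  have hb := bumpConst_pos
  obtain ⟨Q, hQm, hQv, hQb, hQdisj, -⟩ := exists_layerCells c₁ c₂
  set P : ℤ × ℤ → ℝ × ℝ := fun t => ((t.1 : ℝ) + t.2 / 2 + c₁, Real.sqrt 3 / 2 * t.2 + c₂) with hP
  set Ψ : ℝ × ℝ → ℝ := fun q => bumpConst / K ^ 3 *
      (max 0 (1 - (max 0 (Real.sqrt ((max 0 (Real.sqrt ((q.1 - y.1) ^ 2 + (q.2 - y.2) ^ 2) - 2)) ^ 2
        + ζ ^ 2) / K)) ^ 2)) ^ 3 with hΨ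
  have hΨ0 : ∀ q, 0 ≤ Ψ q := fun q =>
    mul_nonneg (div_nonneg hb.le (pow_nonneg hK0.le 3)) (profile_nonneg _)
  -- integrability of Ψ: dominated by bump + indicator (both integrable) — easier: continuous + compact support
  have hind : Integrable fun q : ℝ × ℝ =>
      (closedBall y (K + 2)).indicator (fun _ => 12 * bumpConst / K ^ 4) q :=
    (integrable_indicator_iff measurableSet_closedBall).2
      ((integrableOn_const_iff).2 (Or.inr measure_closedBall_lt_top))
  have hΨle : ∀ q, Ψ q ≤ bump K (![q.1 - y.1, q.2 - y.2, ζ] : Fin 3 → ℝ) +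
      (closedBall y (K + 2)).indicator (fun _ => 12 * bumpConst / K ^ 4) q := fun q => by
    have := lateral_majorant_sub_bump_le hK0 ζ y q
    simp only [hΨ]; linarith
  have hΨint : Integrable Ψ := by
    refine Integrable.mono' ((integrable_bump_sub_plane hK0 ζ y).add hind)
      (continuous_lateral_majorant K ζ y).aestronglyMeasurable (ae_of_all _ fun q => ?_)
    rw [Real.norm_eq_abs, abs_of_nonneg (hΨ0 q)]
    exact hΨle q
  -- per point
  have hvolR : ∀ p, (volume (Q p)).toReal = Real.sqrt 3 / 2 := fun p => by
    rw [hQv, ENNReal.toReal_ofReal (by positivity)]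
  have hpt : ∀ t : ℤ × ℤ, bump K (![y.1 - (P t).1, y.2 - (P t).2, ζ] : Fin 3 → ℝ) ≤
      2 / Real.sqrt 3 * ∫ q in Q (P t), Ψ q := by
    intro t
    have hfin : volume (Q (P t)) < ⊤ := by rw [hQv]; exact ENNReal.ofReal_lt_top
    have h1 : ∫ q in Q (P t), bump K (![y.1 - (P t).1, y.2 - (P t).2, ζ] : Fin 3 → ℝ) =
        Real.sqrt 3 / 2 * bump K (![y.1 - (P t).1, y.2 - (P t).2, ζ] : Fin 3 → ℝ) := by
      rw [setIntegral_const, smul_eq_mul, measureReal_def, hvolR]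
    have h2 : ∫ q in Q (P t), bump K (![y.1 - (P t).1, y.2 - (P t).2, ζ] : Fin 3 → ℝ) ≤
        ∫ q in Q (P t), Ψ q :=
      setIntegral_mono_on ((integrableOn_const_iff).2 (Or.inr hfin)) hΨint.integrableOn (hQm _)
        fun q hq => bump_le_lateral_majorant hK0 ζ y (P t) q (sqrt_le_two_of_cell (hQb _ q hq))
    rw [h1] at h2
    calc bump K (![y.1 - (P t).1, y.2 - (P t).2, ζ] : Fin 3 → ℝ)
        = 2 / Real.sqrt 3 * (Real.sqrt 3 / 2 * bump K (![y.1 - (P t).1, y.2 - (P t).2, ζ] : Fin 3 → ℝ)) := by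
          field_simp
      _ ≤ 2 / Real.sqrt 3 * ∫ q in Q (P t), Ψ q := mul_le_mul_of_nonneg_left h2 (by positivity)
  -- disjointness and summation
  have hdisj : Set.Pairwise (↑F) (Function.onFun Disjoint fun t => Q (P t)) := by
    intro a _ b _ hab
    have hne : (a.1, a.2) ≠ (b.1, b.2) := by simpa using hab
    exact hQdisj a.1 a.2 b.1 b.2 hne
  have hsum : ∑ t ∈ F, ∫ q in Q (P t), Ψ q = ∫ q in ⋃ t ∈ F, Q (P t), Ψ q :=
    (integral_biUnion_finset F (fun t _ => hQm _) hdisj (fun t _ => hΨint.integrableOn)).symm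
  have hle_int : ∫ q in ⋃ t ∈ F, Q (P t), Ψ q ≤ ∫ q, Ψ q :=
    setIntegral_le_integral hΨint (ae_of_all _ hΨ0)
  have hΨtot : ∫ q, Ψ q ≤ layerProf K ζ + 12 * bumpConst / K ^ 4 * ((2 * (K + 2)) * (2 * (K + 2))) := by
    calc ∫ q, Ψ q ≤ ∫ q : ℝ × ℝ, (bump K (![q.1 - y.1, q.2 - y.2, ζ] : Fin 3 → ℝ) +
          (closedBall y (K + 2)).indicator (fun _ => 12 * bumpConst / K ^ 4) q) :=
          integral_mono hΨint ((integrable_bump_sub_plane hK0 ζ y).add hind) hΨle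
      _ = layerProf K ζ + 12 * bumpConst / K ^ 4 * ((2 * (K + 2)) * (2 * (K + 2))) := by
          rw [integral_add (integrable_bump_sub_plane hK0 ζ y) hind, integral_bump_sub_eq_layerProf,
            integral_indicator_const _ measurableSet_closedBall, smul_eq_mul, measureReal_def,
            volume_closedBall_prod_toReal y (by linarith)]
          ring
  calc ∑ t ∈ F, bump K (![y.1 - ((t.1 : ℝ) + t.2 / 2 + c₁), y.2 - (Real.sqrt 3 / 2 * t.2 + c₂), ζ] :
          Fin 3 → ℝ)
      = ∑ t ∈ F, bump K (![y.1 - (P t).1, y.2 - (P t).2, ζ] : Fin 3 → ℝ) := rfl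
    _ ≤ ∑ t ∈ F, 2 / Real.sqrt 3 * ∫ q in Q (P t), Ψ q := Finset.sum_le_sum fun t _ => hpt t
    _ = 2 / Real.sqrt 3 * ∑ t ∈ F, ∫ q in Q (P t), Ψ q := by rw [Finset.mul_sum]
    _ ≤ 2 / Real.sqrt 3 * ∫ q, Ψ q := by
        rw [hsum]; exact mul_le_mul_of_nonneg_left hle_int (by positivity)
    _ ≤ _ := mul_le_mul_of_nonneg_left hΨtot (by positivity)

/-- **Lower per-layer bound.**  If `F` contains every index whose point is within lateral distance
`K` of `y`: `(2/√3)·(layerProf K ζ − 12·bumpConst·(2K)²/K⁴) ≤ Σ_{(i,j)∈F} φ_K(y − P(i,j), ζ)`. -/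
theorem layerSum_ge (c₁ c₂ : ℝ) {K : ℝ} (hK : 1 ≤ K) (ζ : ℝ) (y : ℝ × ℝ) (F : Finset (ℤ × ℤ))
    (hF : ∀ i j : ℤ, Real.sqrt ((y.1 - ((i : ℝ) + j / 2 + c₁)) ^ 2 +
      (y.2 - (Real.sqrt 3 / 2 * j + c₂)) ^ 2) < K → (i, j) ∈ F) :
    2 / Real.sqrt 3 * (layerProf K ζ - 12 * bumpConst / K ^ 4 * ((2 * K) * (2 * K))) ≤
      ∑ t ∈ F, bump K (![y.1 - ((t.1 : ℝ) + t.2 / 2 + c₁), y.2 - (Real.sqrt 3 / 2 * t.2 + c₂), ζ] :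
        Fin 3 → ℝ) := by
  classical
  have hK0 : 0 < K := by linarith
  have h3 : 0 < Real.sqrt 3 := Real.sqrt_pos.2 (by norm_num)
  have hb := bumpConst_pos
  obtain ⟨Q, hQm, hQv, hQb, hQdisj, hQcov⟩ := exists_layerCells c₁ c₂
  set P : ℤ × ℤ → ℝ × ℝ := fun t => ((t.1 : ℝ) + t.2 / 2 + c₁, Real.sqrt 3 / 2 * t.2 + c₂) with hP
  set Ψ : ℝ × ℝ → ℝ := fun q => bumpConst / K ^ 3 *
      (max 0 (1 - (max 0 (Real.sqrt ((Real.sqrt ((q.1 - y.1) ^ 2 + (q.2 - y.2) ^ 2) + 2) ^ 2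
        + ζ ^ 2) / K)) ^ 2)) ^ 3 with hΨ
  have hΨ0 : ∀ q, 0 ≤ Ψ q := fun q =>
    mul_nonneg (div_nonneg hb.le (pow_nonneg hK0.le 3)) (profile_nonneg _)
  have hΨle : ∀ q, Ψ q ≤ bump K (![q.1 - y.1, q.2 - y.2, ζ] : Fin 3 → ℝ) := fun q => by
    have := bump_sub_lateral_minorant_le hK0 ζ y q
    have hi : 0 ≤ (closedBall y K).indicator (fun _ => 12 * bumpConst / K ^ 4) q :=
      Set.indicator_nonneg (fun _ _ => by positivity) q
    -- minorant ≤ bump directly from antitonicity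
    simp only [hΨ]
    rw [bump_vec_eq_profile hK0]
    refine mul_le_mul_of_nonneg_left (profile_antitone ?_) (div_nonneg hb.le (pow_nonneg hK0.le 3))
    apply div_le_div_of_nonneg_right _ hK0.le
    apply Real.sqrt_le_sqrt
    have hr0 : 0 ≤ Real.sqrt ((q.1 - y.1) ^ 2 + (q.2 - y.2) ^ 2) := Real.sqrt_nonneg _
    rw [Real.sq_sqrt (by positivity)]
    nlinarith [Real.sq_sqrt (show 0 ≤ (q.1 - y.1) ^ 2 + (q.2 - y.2) ^ 2 by positivity)]
  have hΨint : Integrable Ψ := by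
    refine Integrable.mono' (integrable_bump_sub_plane hK0 ζ y)
      (continuous_lateral_minorant K ζ y).aestronglyMeasurable (ae_of_all _ fun q => ?_)
    rw [Real.norm_eq_abs, abs_of_nonneg (hΨ0 q)]
    exact hΨle q
  have hvolR : ∀ p, (volume (Q p)).toReal = Real.sqrt 3 / 2 := fun p => by
    rw [hQv, ENNReal.toReal_ofReal (by positivity)]
  -- per point: `(2/√3) ∫_{Q(P t)} Ψ ≤ bump`
  have hpt : ∀ t : ℤ × ℤ, 2 / Real.sqrt 3 * ∫ q in Q (P t), Ψ q ≤
      bump K (![y.1 - (P t).1, y.2 - (P t).2, ζ] : Fin 3 → ℝ) := by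
    intro t
    have hfin : volume (Q (P t)) < ⊤ := by rw [hQv]; exact ENNReal.ofReal_lt_top
    have h1 : ∫ q in Q (P t), bump K (![y.1 - (P t).1, y.2 - (P t).2, ζ] : Fin 3 → ℝ) =
        Real.sqrt 3 / 2 * bump K (![y.1 - (P t).1, y.2 - (P t).2, ζ] : Fin 3 → ℝ) := by
      rw [setIntegral_const, smul_eq_mul, measureReal_def, hvolR]
    have h2 : ∫ q in Q (P t), Ψ q ≤
        ∫ q in Q (P t), bump K (![y.1 - (P t).1, y.2 - (P t).2, ζ] : Fin 3 → ℝ) :=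
      setIntegral_mono_on hΨint.integrableOn ((integrableOn_const_iff).2 (Or.inr hfin)) (hQm _)
        fun q hq => lateral_minorant_le_bump hK0 ζ y (P t) q (sqrt_le_two_of_cell (hQb _ q hq))
    rw [h1] at h2
    calc 2 / Real.sqrt 3 * ∫ q in Q (P t), Ψ q
        ≤ 2 / Real.sqrt 3 * (Real.sqrt 3 / 2 * bump K (![y.1 - (P t).1, y.2 - (P t).2, ζ] : Fin 3 → ℝ)) :=
          mul_le_mul_of_nonneg_left h2 (by positivity)
      _ = _ := by field_simp
  have hdisj : Set.Pairwise (↑F) (Function.onFun Disjoint fun t => Q (P t)) := by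
    intro a _ b _ hab
    have hne : (a.1, a.2) ≠ (b.1, b.2) := by simpa using hab
    exact hQdisj a.1 a.2 b.1 b.2 hne
  have hsum : ∑ t ∈ F, ∫ q in Q (P t), Ψ q = ∫ q in ⋃ t ∈ F, Q (P t), Ψ q :=
    (integral_biUnion_finset F (fun t _ => hQm _) hdisj (fun t _ => hΨint.integrableOn)).symm
  -- covering: Ψ vanishes off the union of the cells of F
  have hcarry : ∫ q in ⋃ t ∈ F, Q (P t), Ψ q = ∫ q, Ψ q := by
    refine setIntegral_eq_integral_of_forall_compl_eq_zero fun q hq => ?_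
    by_contra hne
    apply hq
    obtain ⟨i, j, hmem⟩ := hQcov q
    -- Ψ q ≠ 0 forces `r_q + 2 < K`
    have hr0 : 0 ≤ Real.sqrt ((q.1 - y.1) ^ 2 + (q.2 - y.2) ^ 2) := Real.sqrt_nonneg _
    have hlt : Real.sqrt ((q.1 - y.1) ^ 2 + (q.2 - y.2) ^ 2) + 2 < K := by
      by_contra hge
      rw [not_lt] at hge
      apply hne
      simp only [hΨ]
      have h1 : 1 ≤ Real.sqrt ((Real.sqrt ((q.1 - y.1) ^ 2 + (q.2 - y.2) ^ 2) + 2) ^ 2 + ζ ^ 2) / K := by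
        rw [le_div_iff₀ hK0, one_mul]
        calc K ≤ Real.sqrt ((q.1 - y.1) ^ 2 + (q.2 - y.2) ^ 2) + 2 := hge
          _ = Real.sqrt ((Real.sqrt ((q.1 - y.1) ^ 2 + (q.2 - y.2) ^ 2) + 2) ^ 2) :=
              (Real.sqrt_sq (by linarith)).symm
          _ ≤ _ := Real.sqrt_le_sqrt (by nlinarith)
      have : max 0 (1 - (max 0 (Real.sqrt ((Real.sqrt ((q.1 - y.1) ^ 2 + (q.2 - y.2) ^ 2) + 2) ^ 2
          + ζ ^ 2) / K)) ^ 2) = 0 := by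
        refine max_eq_left ?_
        have hm : 1 ≤ max 0 (Real.sqrt ((Real.sqrt ((q.1 - y.1) ^ 2 + (q.2 - y.2) ^ 2) + 2) ^ 2
          + ζ ^ 2) / K) := le_max_of_le_right h1
        nlinarith
      rw [this]; ring
    -- the base point of the covering cell is within `K` of `y`
    have hcell := hQb _ q hmem
    have hd := sqrt_le_two_of_cell hcell
    have htri := sqrt_sq_add_sq_add_le (y.1 - q.1) (y.2 - q.2)
      (q.1 - ((i : ℝ) + j / 2 + c₁)) (q.2 - (Real.sqrt 3 / 2 * j + c₂))
    rw [show y.1 - q.1 + (q.1 - ((i : ℝ) + j / 2 + c₁)) = y.1 - ((i : ℝ) + j / 2 + c₁) by ring,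
      show y.2 - q.2 + (q.2 - (Real.sqrt 3 / 2 * j + c₂)) = y.2 - (Real.sqrt 3 / 2 * j + c₂) by ring]
      at htri
    have e : Real.sqrt ((y.1 - q.1) ^ 2 + (y.2 - q.2) ^ 2) =
        Real.sqrt ((q.1 - y.1) ^ 2 + (q.2 - y.2) ^ 2) := by congr 1; ring
    rw [e] at htri
    have hin : (i, j) ∈ F := hF i j (by simp only at hd ⊢; linarith)
    exact Set.mem_biUnion hin hmem
  have hΨtot : layerProf K ζ - 12 * bumpConst / K ^ 4 * ((2 * K) * (2 * K)) ≤ ∫ q, Ψ q := by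
    have hind : Integrable fun q : ℝ × ℝ =>
        (closedBall y K).indicator (fun _ => 12 * bumpConst / K ^ 4) q :=
      (integrable_indicator_iff measurableSet_closedBall).2
        ((integrableOn_const_iff).2 (Or.inr measure_closedBall_lt_top))
    have h1 : ∫ q : ℝ × ℝ, bump K (![q.1 - y.1, q.2 - y.2, ζ] : Fin 3 → ℝ) ≤
        ∫ q : ℝ × ℝ, (Ψ q + (closedBall y K).indicator (fun _ => 12 * bumpConst / K ^ 4) q) :=
      integral_mono (integrable_bump_sub_plane hK0 ζ y) (hΨint.add hind) fun q => by
        have := bump_sub_lateral_minorant_le hK0 ζ y q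
        simp only [hΨ] at this ⊢; linarith
    rw [integral_add hΨint hind, integral_bump_sub_eq_layerProf,
      integral_indicator_const _ measurableSet_closedBall, smul_eq_mul, measureReal_def,
      volume_closedBall_prod_toReal y hK0.le] at h1
    linarith
  calc 2 / Real.sqrt 3 * (layerProf K ζ - 12 * bumpConst / K ^ 4 * ((2 * K) * (2 * K)))
      ≤ 2 / Real.sqrt 3 * ∫ q, Ψ q := mul_le_mul_of_nonneg_left hΨtot (by positivity)
    _ = 2 / Real.sqrt 3 * ∑ t ∈ F, ∫ q in Q (P t), Ψ q := by rw [hsum, hcarry]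
    _ = ∑ t ∈ F, 2 / Real.sqrt 3 * ∫ q in Q (P t), Ψ q := by rw [Finset.mul_sum]
    _ ≤ ∑ t ∈ F, bump K (![y.1 - (P t).1, y.2 - (P t).2, ζ] : Fin 3 → ℝ) :=
        Finset.sum_le_sum fun t _ => hpt t
    _ = _ := rfl

end Summit.Ventures.Crystal3D.Theorems.PlateauHeight

end
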